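import Summits.QuantumFields.BalabanUV.Beta.GAN24.MonotoneLoewner

/-!
# Beta / GAN24 / MonotoneTraceNorm — where monotonicity buys a CONSTANT, not only a rate: for a PSD deviation the entrywise `ℓ¹` size IS the trace
# (gan24-p4, BINDER-OWNERS row G-an2-4 ∕ (CONV-C), «rate OR monotonicity»; caveat Q-gan24p4-1 of `HOME/b2b-balaban-gan24-p4/MONOTONE.md`, variant V11; NOT IN PRINT — our proof attempt)

HONEST FRAMING (page 1 of everything the β sub-cell writes): discharging `BetaPertH` makes Bałaban's UV stability UNCONDITIONAL — a
real constructive-QFT result; it is NOT the continuum limit and NOT the Clay problem.  HONEST DEPENDENCY (cell reorg 2026-08-19, verbatim):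
«continuum YM on T⁴ ⇐ BetaPertH ∧ nine spine estimates (0/9 proved); BetaPertH ⇐ (D1) ∧ (D4) ∧ CAP+tail; G-an2-4 gates asym, D1 and NE2/3/4.»
ABSOLUTE RULE (cell charter, verbatim): "No internally-minted statement may enter as a cited fact. Every hypothesis is either
kernel-proved in this package or a verbatim quotation of a PUBLISHED theorem with page reference. The manuscript(s) under audit are
NOT citable for their own disputed steps — they are the thing under adjudication; programme-internal (2001/route/tribunal) claims
are never citable."  Nothing is cited; [folklore] (Hölder `|tr(XD)| ≤ ‖X‖·tr D` for `D ⪰ 0`, finite-dimensional).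

## WHY.  The band widths of `GAN24/MonotoneCauchy` ∕ `MonotoneSchur` multiply the deviation of the resolvent slot by a Lipschitz budget built for SIGNED
deviations (exponentially weighted sup∕Schur norms).  Along a Loewner chain the deviations `D = P j − P j'` are PSD, and for PSD matrices the
entrywise `ℓ¹` mass is controlled by the TRACE ALONE (`sum_norm_apply_le`): `Σ_{a,b} ‖D a b‖ ≤ |n|·re tr D`; hence every pairing against a bounded
test matrix is Hölder-bounded by ONE scalar, the trace lost (`norm_trace_mul_le`, `norm_sum_mul_apply_le`).  Per Bloch fibre this is the mechanism
by which a one-loop functional with bounded vertex symbols is Lipschitz in the propagator with constant (sup of the vertex data) × (trace datum) —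
no lattice constant, no rate halving (census V11; the zone-integral ∕ second-moment bookkeeping is asym1's `MomentSymbol` currency and is NOT done here).
-/

namespace Summit.QuantumFields.BalabanUV.Beta.GAN24.MonotoneTraceNorm

open scoped ComplexOrder
open Matrix Finset
open Summit.QuantumFields.BalabanUV.Beta.GAN24.MonotoneLoewner (norm_apply_sq_le re_diag_nonneg re_trace_eq_sum)

variable {n : Type*} [Fintype n] {D : Matrix n n ℂ}

omit [Fintype n] in
/-- PSD ⟹ `‖D a b‖ ≤ (re D a a + re D b b)/2` (geometric ≤ arithmetic mean on `norm_apply_sq_le`). [folklore] -/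
theorem norm_apply_le_half_diag (hD : D.PosSemidef) (a b : n) : ‖D a b‖ ≤ ((D a a).re + (D b b).re) / 2 := by
  have h := norm_apply_sq_le hD a b
  have ha := re_diag_nonneg hD a
  have hb := re_diag_nonneg hD b
  nlinarith [norm_nonneg (D a b), sq_nonneg ((D a a).re - (D b b).re), sq_nonneg (‖D a b‖ - ((D a a).re + (D b b).re) / 2)]

/-- **PSD ⟹ THE ENTRYWISE `ℓ¹` MASS IS AT MOST `|n|·re tr D`.** [folklore] -/
theorem sum_norm_apply_le (hD : D.PosSemidef) : ∑ a, ∑ b, ‖D a b‖ ≤ (Fintype.card n : ℝ) * D.trace.re := by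
  calc ∑ a, ∑ b, ‖D a b‖ ≤ ∑ a, ∑ b, ((D a a).re + (D b b).re) / 2 :=
        Finset.sum_le_sum fun a _ => Finset.sum_le_sum fun b _ => norm_apply_le_half_diag hD a b
    _ = (Fintype.card n : ℝ) * ∑ a, (D a a).re := by
        have e1 : ∀ a : n, ∑ b : n, ((D a a).re + (D b b).re) / 2 = (Fintype.card n : ℝ) * ((D a a).re / 2) + (∑ b : n, (D b b).re) / 2 := by
          intro a
          simp only [add_div, Finset.sum_add_distrib, Finset.sum_const, Finset.card_univ, nsmul_eq_mul, Finset.sum_div]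
        simp only [e1, Finset.sum_add_distrib, Finset.sum_const, Finset.card_univ, nsmul_eq_mul, ← Finset.mul_sum, ← Finset.sum_div]
        ring
    _ = (Fintype.card n : ℝ) * D.trace.re := by rw [re_trace_eq_sum]

/-- **HÖLDER AGAINST A BOUNDED TEST MATRIX**: `|Σ_{a,b} X a b · D b a| ≤ (sup ‖X‖)·|n|·re tr D` for PSD `D`. [folklore] -/
theorem norm_sum_mul_apply_le (hD : D.PosSemidef) {X : Matrix n n ℂ} {M : ℝ} (hX : ∀ a b, ‖X a b‖ ≤ M) :
    ‖∑ a, ∑ b, X a b * D b a‖ ≤ M * ((Fintype.card n : ℝ) * D.trace.re) := by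
  rcases isEmpty_or_nonempty n with hn | ⟨⟨a₀⟩⟩
  · simp
  have hM : 0 ≤ M := (norm_nonneg _).trans (hX a₀ a₀)
  calc ‖∑ a, ∑ b, X a b * D b a‖ ≤ ∑ a, ∑ b, ‖X a b * D b a‖ :=
        (norm_sum_le _ _).trans (Finset.sum_le_sum fun a _ => norm_sum_le _ _)
    _ ≤ ∑ a, ∑ b, M * ‖D b a‖ := Finset.sum_le_sum fun a _ => Finset.sum_le_sum fun b _ => by
        rw [norm_mul]; exact mul_le_mul_of_nonneg_right (hX a b) (norm_nonneg _)
    _ = M * ∑ b, ∑ a, ‖D b a‖ := by rw [Finset.sum_comm]; simp [Finset.mul_sum]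
    _ ≤ M * ((Fintype.card n : ℝ) * D.trace.re) := mul_le_mul_of_nonneg_left (sum_norm_apply_le hD) hM

/-- in particular `‖tr (X * D)‖ ≤ (sup ‖X‖)·|n|·re tr D`. [folklore] -/
theorem norm_trace_mul_le (hD : D.PosSemidef) {X : Matrix n n ℂ} {M : ℝ} (hX : ∀ a b, ‖X a b‖ ≤ M) :
    ‖(X * D).trace‖ ≤ M * ((Fintype.card n : ℝ) * D.trace.re) := by
  have e : (X * D).trace = ∑ a, ∑ b, X a b * D b a := by
    simp only [Matrix.trace, Matrix.diag, Matrix.mul_apply]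
  rw [e]
  exact norm_sum_mul_apply_le hD hX

end Summit.QuantumFields.BalabanUV.Beta.GAN24.MonotoneTraceNorm
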